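import Summits.QuantumFields.YangMills.Theorems.UnitScaleTiltProp7TwistedLevelMassT3
import Summits.QuantumFields.YangMills.Theorems.UnitScaleTiltProp7FrameRem2Step
import Summits.QuantumFields.YangMills.Theorems.UnitScaleTiltProp7StairRem2Row
import HarnessLib

/-!
# `UnitScaleTiltProp7FrameRem2RecursionT3` — THE SECOND-ORDER FRAME-REMAINDER RECURSION AT T³ (d = 3, `SU(2)`; R0-RECURSION file F-γ2): for every `l < K − n`,
# **`Ψ_{l+1} ≤ (L³)⁻¹·Ψ_l + (9L²∕2 + 171L²)·M^{sb}_l + (3L∕2)·D_l + 91·Φ_l`**, `Ψ_l := Σ_x ‖v_l(x) − 1 − ℓ_l(x)‖`, under (n3)'s binders + the (0.4) guards VERBATIM (✓px17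
# `frameMass_recursion_T3`'s), ABSTRACT linear-part families `ℓ` (frames) ∕ `ℓY` (links) tied by the displayed recursion identity, and the displayed «(n3)₂-sym» rows `D`
(route `UnitScaleTilt`, crux K1 «MinimiserStabilityRegPr» stmt-QuantumFields-19200; ★★OWNER RULINGS №19 (3)∕№20; LOCATE `LOCATE-R0-RECURSION-px13g6.md` + ADDENDUM A1; the T³ twin AT SECOND ORDER
of ✓px17 `Prop7TwistedLevelMassT3.frameMass_recursion_T3`, feeding ✓`Prop7FrameRem2Step.frameRem2_step_le` (F-α) with ✓`Prop7StairRem2Row` (F-β); def-free, count-neutral).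
Cell `ym3-torus` (HUMAN RULING D-0037, YM ladder rung R3 — YM₃ on T³ is a rung, not d = 4, not infinite volume, not a mass gap, not Clay), width seat `ym3-torus-px13` (gen 6).

THE LETTERS.  `U₀ W : GaugeField (F.P K) 0 SU(2)` (background∕competitor), `♭ = unitsField ∘ toUField`, `v_l = frameAccU l U₀♭ W♭`, the plain towers `Ūˡ = iter l U₀`, `W̄ˡ = iter l W` (`Averaging.iter blockAvg`),
`Y_l = pertVar Ūˡ W̄ˡ`, `M^{sb}_l = Σ_b‖Y_l b‖²`, `Φ_l = Σ_x‖v_l x − 1‖²`; linear parts: `ℓ l : Site → M₂` (frames), `ℓY l : PBond → M₂` (links), the stair's `covWalkSum Ūˡ (ℓY l) Γ_i(y)`, and the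
RECURSION IDENTITY `hℓ : ℓ (l+1) y = |Idx|⁻¹•Σ_i (covWalkSum Ūˡ (ℓY l) Γ_i(y) + ν_i·ℓ l (x_i)·ν_i⁻¹)` (satisfied by the Fréchet derivatives: ★routeR-w2 ✓`Prop7SymFrameLinearResponseStep.fderiv_coe_frameAccU_succ_apply`
∘ ✓`Prop7HolRatioLinearResponse.fderiv_holT_ratio_apply` — F-γ3); «(n3)₂-sym» rows `hD : ‖Y_l b − ℓY l b‖ ≤ D l b` (the plain symmetric tower's second-order single-bar remainder — sym twin of `hMcomb₂`; OPEN).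
WHAT IS PROVED (sorry-free): `walkMass_le_one_of_stairμ` (walk mass `≤ μ∕2 ≤ 1` from the two-block sup) and ★★★ `frameRem2_recursion_T3` (the title) — the `hΨ` row of ✓`Prop7FrameRem2Induction.frameRem2_induction`
at `c_B = 9L²∕2 + 171L²`, `c_D = 3L∕2`, `c_Φ = 91`, `q = (L³)⁻¹`.
HONEST FRAMING.  Bookkeeping over F-α∕F-β∕px17's rows; `D` and the recursion identity displayed; nothing of REM2ˢ's analytic content («(n3)₂-sym»), (β), hPA2, hcoS, E′, EX or the crux is proved;
rung R3, not Clay; YM gap NOT proved.  `--supports stmt-QuantumFields-19200 --as helper`.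
References: T. Bałaban, CMP 98 (1985) 17–51 [Balaban1985Averaging] ((82) p.30, (97) p.32, Prop. 3 (122)–(126) p.36); CMP 109 (1987) 249–301 [Balaban1987RG1] ((0.3)–(0.4) pp.252–253).
-/

set_option autoImplicit false

noncomputable section

open scoped BigOperators Matrix.Norms.L2Operator

namespace Summit.QuantumFields.YangMills.Theorems.Prop7FrameRem2RecursionT3

open Finset
open Literature.MathematicalPhysics.QuantumFieldTheory.Balaban1983to89
open Literature.MathematicalPhysics.QuantumFieldTheory.Balaban1983to89.T3ContinuumYM3Torus
open T4Continuum T4ReflectionCone BlockAveraging AveragingRT ExpMeanLog BlockAveragingEMLLinearisedBackground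
open B10Eq27TorusAxialLog (holT transl unitsField toUField)
open B7Prop1Explicit (disp)
open Summit.QuantumFields.YangMills.Theorems.Prop8Chart (emlIterU)
open Summit.QuantumFields.YangMills.Theorems.Prop7SymAvgTwSym (frameAccU)
open Summit.QuantumFields.YangMills.Theorems.Prop7TwistedLinkFrameSup (supStep_le)
open Summit.QuantumFields.YangMills.Theorems.Prop7TwistedTowerFramesT3 (emlIterU_eq_unitsField_iter coe_holT_unitsField_mem_su2 coe_holT_mul_inv_eq stair_row_of_twoBlockSup rho_facts mu_le_rho frameAccU_su2_and_sup
  walkSum_le_length_mul_sqrt length_walk_stairWord_le)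
open Summit.QuantumFields.YangMills.Theorems.Prop7FrameCorrectedMinusMean (norm_le_one_of_mem_specialUnitaryGroup)
open Summit.QuantumFields.YangMills.Theorems.Prop7FrameRem2Step (frameRem2_step_le)
open Summit.QuantumFields.YangMills.Theorems.Prop7StairRem2Row (norm_stairRatio_sub_one_sub_lin_le sum_sum_filter_blockOf_eq)

section T3

variable (F : T3Family) (n K : ℕ)

/-- the walk mass of a centre staircase is at most `μ∕2 ≤ 1` once `3L·√B(y) ≤ μ` and `72μ ≤ 1` (walk length `≤ 3L∕2`, bonds in `B(y)`). [cite: Balaban1987RG1, (0.3) p.252] -/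
theorem walkMass_le_one_of_stairμ {l : ℕ} (hlK : l + 1 ≤ (F.P K).m + (F.P K).K) (V₀ V : GaugeField (F.P K) l (Matrix.specialUnitaryGroup (Fin 2) ℂ)) {μ : ℝ} (hμ72 : 72 * μ ≤ 1)
    (hstairμ : ∀ y : Site (F.P K) (l + 1), 3 * (F.L : ℝ) * Real.sqrt (∑ b ∈ univ.filter (fun b : PBond (F.P K) l => blockOf b.src = y), ‖pertVar V₀ V b‖ ^ 2) ≤ μ)
    (y : Site (F.P K) (l + 1)) (i : Idx (F.P K)) :
    ((walk (emb y) (stairWord i.2.1 (off i.1))).map fun s => ‖pertVar V₀ V s.bond‖).sum ≤ 1 := by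
  have hd : (F.P K).d = 3 := T3Family.P_d F K
  have hws := walkSum_le_length_mul_sqrt (pertVar V₀ V) y (walk (emb y) (stairWord i.2.1 (off i.1)))
    fun s hs => (B12B0LoopGeometry267.stair_src_tgt_blockOf hlK y i.2.1 i.1 s hs).1
  have hlen := length_walk_stairWord_le hd y i
  have hS0 : 0 ≤ Real.sqrt (∑ b ∈ univ.filter (fun b : PBond (F.P K) l => blockOf b.src = y), ‖pertVar V₀ V b‖ ^ 2) := Real.sqrt_nonneg _
  have hLL : ((F.P K).L : ℝ) = F.L := rfl
  rw [hLL] at hlen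
  have h1 := hws.trans (mul_le_mul_of_nonneg_right hlen hS0)
  have h2 := hstairμ y
  nlinarith [h1, h2, hS0]

/-- ★★★ **THE SECOND-ORDER FRAME-REMAINDER RECURSION AT T³** (d = 3, `SU(2)`): under ✓`frameMass_recursion_T3`'s binders VERBATIM (the (0.4) guards `hU₀g hWg`, the two-block sups `μ`, `hμ72`,
`θ`, `hμθ`, `hθL`), abstract linear parts `ℓ`, `ℓY` with the recursion identity `hℓ`, and the displayed «(n3)₂-sym» rows `hD` (`D ≥ 0`): for every `l < K − n`,
`Σ_y ‖v_{l+1}(y) − 1 − ℓ (l+1) y‖ ≤ (L³)⁻¹·Σ_x ‖v_l(x) − 1 − ℓ l x‖ + (9L²∕2 + 171L²)·Σ_b‖Y_l b‖² + (3L∕2)·Σ_b D l b + 91·Σ_x‖v_l(x) − 1‖²`.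
[cite: Balaban1985Averaging, (82) p.30, (97) p.32, Prop. 3 (122)-(126) p.36; Balaban1987RG1, (0.3)-(0.4) pp.252-253] -/
theorem frameRem2_recursion_T3 (U₀ W : GaugeField (F.P K) 0 (Matrix.specialUnitaryGroup (Fin 2) ℂ))
    (hU₀g : ∀ i, i < K - n → ∀ c : PBond (F.P K) (i + 1), Small (expMeanLogSU (n := Fin 2)) (Averaging.iter (fun j => blockAvg (P := F.P K) (j := j) (expMeanLogSU (n := Fin 2))) i U₀) c)
    (hWg : ∀ i, i < K - n → ∀ c : PBond (F.P K) (i + 1), Small (expMeanLogSU (n := Fin 2)) (Averaging.iter (fun j => blockAvg (P := F.P K) (j := j) (expMeanLogSU (n := Fin 2))) i W) c)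
    (μ : ℕ → ℝ)
    (hμ : ∀ j < K - n, ∀ c : PBond (F.P K) (j + 1), ((((F.P K).d + 2) * (F.P K).L : ℕ) : ℝ) * ∑ b ∈ (univ.filter (fun b : PBond (F.P K) j => blockOf b.src = c.src ∨ blockOf b.src = c.tgt)), ‖(pertVar (Averaging.iter (fun i => blockAvg (P := (F.P K)) (j := i) (expMeanLogSU (n := Fin 2))) j U₀) (Averaging.iter (fun i => blockAvg (P := (F.P K)) (j := i) (expMeanLogSU (n := Fin 2))) j W)) b‖ ≤ μ j)
    (hμ72 : ∀ j < K - n, 72 * μ j ≤ 1)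
    {θ : ℝ} (hθ0 : 0 ≤ θ) (hμθ : ∀ j < K - n, 7800 * (F.L : ℝ) ^ 3 * (F.L : ℝ) ^ (K - n) * μ j ≤ θ * (F.L : ℝ) ^ j)
    (hθL : 1000 * θ * (F.L : ℝ) ≤ 1)
    (ℓ : (l : ℕ) → Site (F.P K) l → Matrix (Fin 2) (Fin 2) ℂ) (ℓY : (l : ℕ) → PBond (F.P K) l → Matrix (Fin 2) (Fin 2) ℂ)
    (hℓ : ∀ l, l < K - n → ∀ y : Site (F.P K) (l + 1), ℓ (l + 1) y
      = ((Fintype.card (Idx (F.P K)) : ℂ))⁻¹ • ∑ i : Idx (F.P K),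
          (covWalkSum (Averaging.iter (fun j => blockAvg (P := (F.P K)) (j := j) (expMeanLogSU (n := Fin 2))) l U₀) (ℓY l) (walk (emb y) (stairWord i.2.1 (off i.1)))
            + ((holT (emlIterU l (unitsField (toUField U₀))) (emb y) (stairWord i.2.1 (off i.1)) : (Matrix (Fin 2) (Fin 2) ℂ)ˣ) : Matrix (Fin 2) (Fin 2) ℂ)
              * ℓ l (transl (emb y) (disp (stairWord i.2.1 (off i.1))))
              * (((holT (emlIterU l (unitsField (toUField U₀))) (emb y) (stairWord i.2.1 (off i.1)))⁻¹ : (Matrix (Fin 2) (Fin 2) ℂ)ˣ) : Matrix (Fin 2) (Fin 2) ℂ)))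
    (D : (l : ℕ) → PBond (F.P K) l → ℝ) (hD0 : ∀ l b, 0 ≤ D l b)
    (hD : ∀ l, l < K - n → ∀ b : PBond (F.P K) l,
      ‖pertVar (Averaging.iter (fun i => blockAvg (P := (F.P K)) (j := i) (expMeanLogSU (n := Fin 2))) l U₀) (Averaging.iter (fun i => blockAvg (P := (F.P K)) (j := i) (expMeanLogSU (n := Fin 2))) l W) b
        - ℓY l b‖ ≤ D l b) :
    ∀ l, l < K - n →
      ∑ y : Site (F.P K) (l + 1), ‖((frameAccU (l + 1) (unitsField (toUField U₀)) (unitsField (toUField W)) y : (Matrix (Fin 2) (Fin 2) ℂ)ˣ) : Matrix (Fin 2) (Fin 2) ℂ) - 1 - ℓ (l + 1) y‖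
        ≤ ((F.L : ℝ) ^ 3)⁻¹ * ∑ x : Site (F.P K) l, ‖((frameAccU l (unitsField (toUField U₀)) (unitsField (toUField W)) x : (Matrix (Fin 2) (Fin 2) ℂ)ˣ) : Matrix (Fin 2) (Fin 2) ℂ) - 1 - ℓ l x‖
          + (9 * (F.L : ℝ) ^ 2 / 2 + 171 * (F.L : ℝ) ^ 2)
              * ∑ b : PBond (F.P K) l, ‖(pertVar (Averaging.iter (fun i => blockAvg (P := (F.P K)) (j := i) (expMeanLogSU (n := Fin 2))) l U₀) (Averaging.iter (fun i => blockAvg (P := (F.P K)) (j := i) (expMeanLogSU (n := Fin 2))) l W)) b‖ ^ 2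
          + 3 * (F.L : ℝ) / 2 * ∑ b : PBond (F.P K) l, D l b
          + 91 * ∑ x : Site (F.P K) l, ‖((frameAccU l (unitsField (toUField U₀)) (unitsField (toUField W)) x : (Matrix (Fin 2) (Fin 2) ℂ)ˣ) : Matrix (Fin 2) (Fin 2) ℂ) - 1‖ ^ 2 := by
  have hL3 : (3 : ℝ) ≤ F.L := Prop7CurvedLandauKnitT3.three_le_L F
  have hL0 : (0 : ℝ) < F.L := by linarith
  have hd : (F.P K).d = 3 := T3Family.P_d F K
  have hLL : ((F.P K).L : ℝ) = F.L := rfl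
  intro l hl'
  have hlK : l + 1 ≤ (F.P K).m + (F.P K).K := by show l + 1 ≤ F.m + K; have := F.hm; omega
  -- letters at level `l`
  set V₀ : GaugeField (F.P K) l (Matrix.specialUnitaryGroup (Fin 2) ℂ) := Averaging.iter (fun i => blockAvg (P := (F.P K)) (j := i) (expMeanLogSU (n := Fin 2))) l U₀ with hV₀
  set V : GaugeField (F.P K) l (Matrix.specialUnitaryGroup (Fin 2) ℂ) := Averaging.iter (fun i => blockAvg (P := (F.P K)) (j := i) (expMeanLogSU (n := Fin 2))) l W with hV
  obtain ⟨hsu, hsup⟩ := frameAccU_su2_and_sup F n K U₀ W hU₀g hWg μ hμ hμ72 hθ0 hμθ hθL l hl'.le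
  obtain ⟨hρ0, -, hρ6, hρL6⟩ := rho_facts hL3 hθ0 hθL (K - n) l hl'
  have hUeq := emlIterU_eq_unitsField_iter U₀ (K - n) hU₀g hl'.le
  have hWeq := emlIterU_eq_unitsField_iter W (K - n) hWg hl'.le
  have hv1 : ∀ x : Site (F.P K) l, ‖((frameAccU l (unitsField (toUField U₀)) (unitsField (toUField W)) x : (Matrix (Fin 2) (Fin 2) ℂ)ˣ) : Matrix (Fin 2) (Fin 2) ℂ)‖ ≤ 1 :=
    fun x => (norm_le_one_of_mem_specialUnitaryGroup (hsu x)).1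
  have hv1' : ∀ x : Site (F.P K) l, ‖(((frameAccU l (unitsField (toUField U₀)) (unitsField (toUField W)) x)⁻¹ : (Matrix (Fin 2) (Fin 2) ℂ)ˣ) : Matrix (Fin 2) (Fin 2) ℂ)‖ ≤ 1 :=
    fun x => (norm_le_one_of_mem_specialUnitaryGroup (hsu x)).2
  have hν : ∀ (y : Site (F.P K) (l + 1)) (i : Idx (F.P K)),
      ‖((holT (emlIterU l (unitsField (toUField U₀))) (emb y) (stairWord i.2.1 (off i.1)) : (Matrix (Fin 2) (Fin 2) ℂ)ˣ) : Matrix (Fin 2) (Fin 2) ℂ)‖ ≤ 1 ∧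
      ‖(((holT (emlIterU l (unitsField (toUField U₀))) (emb y) (stairWord i.2.1 (off i.1)))⁻¹ : (Matrix (Fin 2) (Fin 2) ℂ)ˣ) : Matrix (Fin 2) (Fin 2) ℂ)‖ ≤ 1 := by
    intro y i
    have hsuT : ((holT (emlIterU l (unitsField (toUField U₀))) (emb y) (stairWord i.2.1 (off i.1)) : (Matrix (Fin 2) (Fin 2) ℂ)ˣ) : Matrix (Fin 2) (Fin 2) ℂ) ∈ Matrix.specialUnitaryGroup (Fin 2) ℂ := by
      rw [hUeq]; exact coe_holT_unitsField_mem_su2 _ _ _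
    exact norm_le_one_of_mem_specialUnitaryGroup hsuT
  obtain ⟨hstair, hstairμ⟩ := stair_row_of_twoBlockSup hd hlK V₀ V (hμ l hl') (hμ72 l hl')
  have hμρ : μ l ≤ θ * (F.L : ℝ) ^ l / (7800 * (F.L : ℝ) ^ 3 * (F.L : ℝ) ^ (K - n)) := mu_le_rho hL0 (K - n) l (hμθ l hl')
  have hR : ∀ (y : Site (F.P K) (l + 1)) (i : Idx (F.P K)),
      ‖((holT (emlIterU l (unitsField (toUField W))) (emb y) (stairWord i.2.1 (off i.1)) * (holT (emlIterU l (unitsField (toUField U₀))) (emb y) (stairWord i.2.1 (off i.1)))⁻¹ :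
          (Matrix (Fin 2) (Fin 2) ℂ)ˣ) : Matrix (Fin 2) (Fin 2) ℂ) - 1‖
        ≤ 3 * (F.L : ℝ) * Real.sqrt (∑ b ∈ univ.filter (fun b : PBond (F.P K) l => blockOf b.src = y), ‖pertVar V₀ V b‖ ^ 2) := by
    intro y i
    rw [hUeq, hWeq, coe_holT_mul_inv_eq]
    exact hstair y i
  have hρB : ∀ y : Site (F.P K) (l + 1), 3 * (F.L : ℝ) * Real.sqrt (∑ b ∈ univ.filter (fun b : PBond (F.P K) l => blockOf b.src = y), ‖pertVar V₀ V b‖ ^ 2)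
        ≤ θ * (F.L : ℝ) ^ l / (7800 * (F.L : ℝ) ^ 3 * (F.L : ℝ) ^ (K - n)) := fun y => (hstairμ y).trans hμρ
  obtain ⟨-, hwin⟩ := supStep_le _ _ _ hρ0 (by linarith) (by positivity) le_rfl (le_refl (2 * (θ * (F.L : ℝ) ^ l / (7800 * (F.L : ℝ) ^ 3 * (F.L : ℝ) ^ (K - n)))))
  -- the second-order stair row (F-β, plain tower), pointwise, read through the `holT ↔ holAt` dictionary
  have hm1 : ∀ (y : Site (F.P K) (l + 1)) (i : Idx (F.P K)), ((walk (emb y) (stairWord i.2.1 (off i.1))).map fun s => ‖pertVar V₀ V s.bond‖).sum ≤ 1 :=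
    fun y i => walkMass_le_one_of_stairμ F K hlK V₀ V (hμ72 l hl') hstairμ y i
  have hSR : ∀ (y : Site (F.P K) (l + 1)) (i : Idx (F.P K)),
      ‖((holT (emlIterU l (unitsField (toUField W))) (emb y) (stairWord i.2.1 (off i.1)) * (holT (emlIterU l (unitsField (toUField U₀))) (emb y) (stairWord i.2.1 (off i.1)))⁻¹ :
          (Matrix (Fin 2) (Fin 2) ℂ)ˣ) : Matrix (Fin 2) (Fin 2) ℂ) - 1 - covWalkSum V₀ (ℓY l) (walk (emb y) (stairWord i.2.1 (off i.1)))‖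
        ≤ 9 * (F.L : ℝ) ^ 2 / 2 * ∑ b ∈ univ.filter (fun b : PBond (F.P K) l => blockOf b.src = y), ‖pertVar V₀ V b‖ ^ 2
          + 3 * (F.L : ℝ) / 2 * ∑ b ∈ univ.filter (fun b : PBond (F.P K) l => blockOf b.src = y), D l b := by
    intro y i
    rw [hUeq, hWeq, coe_holT_mul_inv_eq]
    have h := norm_stairRatio_sub_one_sub_lin_le hd hlK V₀ V (ℓY l) (D l) (hD0 l) (hD l hl') y i (hm1 y i)
    rw [hLL] at h
    exact h
  -- F-α at level `l`
  have hstep := frameRem2_step_le hlK (unitsField (toUField U₀)) (unitsField (toUField W))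
    (fun y => ∑ b ∈ univ.filter (fun b : PBond (F.P K) l => blockOf b.src = y), ‖pertVar V₀ V b‖ ^ 2)
    (by positivity : (0 : ℝ) ≤ 3 * (F.L : ℝ)) (fun y => Finset.sum_nonneg fun _ _ => sq_nonneg _) (by positivity) hρ0 hv1 hv1' hν hsup hR hρB hwin
    (ℓ l) (fun x => ‖((frameAccU l (unitsField (toUField U₀)) (unitsField (toUField W)) x : (Matrix (Fin 2) (Fin 2) ℂ)ˣ) : Matrix (Fin 2) (Fin 2) ℂ) - 1 - ℓ l x‖) (fun x => le_rfl)
    (fun y i => covWalkSum V₀ (ℓY l) (walk (emb y) (stairWord i.2.1 (off i.1))))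
    (fun y _ => 9 * (F.L : ℝ) ^ 2 / 2 * ∑ b ∈ univ.filter (fun b : PBond (F.P K) l => blockOf b.src = y), ‖pertVar V₀ V b‖ ^ 2
      + 3 * (F.L : ℝ) / 2 * ∑ b ∈ univ.filter (fun b : PBond (F.P K) l => blockOf b.src = y), D l b) hSR
  -- the linear part of the new frame IS `ℓ (l+1)` (recursion identity), and the sums
  have hcard : (0 : ℝ) < Fintype.card (Idx (F.P K)) := Nat.cast_pos.2 Fintype.card_pos
  have hLHS : ∀ y : Site (F.P K) (l + 1),
      ‖((frameAccU (l + 1) (unitsField (toUField U₀)) (unitsField (toUField W)) y : (Matrix (Fin 2) (Fin 2) ℂ)ˣ) : Matrix (Fin 2) (Fin 2) ℂ) - 1 - ℓ (l + 1) y‖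
        = ‖((frameAccU (l + 1) (unitsField (toUField U₀)) (unitsField (toUField W)) y : (Matrix (Fin 2) (Fin 2) ℂ)ˣ) : Matrix (Fin 2) (Fin 2) ℂ) - 1
            - ((Fintype.card (Idx (F.P K)) : ℂ))⁻¹ • ∑ i : Idx (F.P K),
                (covWalkSum V₀ (ℓY l) (walk (emb y) (stairWord i.2.1 (off i.1)))
                  + ((holT (emlIterU l (unitsField (toUField U₀))) (emb y) (stairWord i.2.1 (off i.1)) : (Matrix (Fin 2) (Fin 2) ℂ)ˣ) : Matrix (Fin 2) (Fin 2) ℂ)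
                    * ℓ l (transl (emb y) (disp (stairWord i.2.1 (off i.1))))
                    * (((holT (emlIterU l (unitsField (toUField U₀))) (emb y) (stairWord i.2.1 (off i.1)))⁻¹ : (Matrix (Fin 2) (Fin 2) ℂ)ˣ) : Matrix (Fin 2) (Fin 2) ℂ))‖ := by
    intro y; rw [hℓ l hl' y]
  have hSRsum : ∑ y : Site (F.P K) (l + 1), (Fintype.card (Idx (F.P K)) : ℝ)⁻¹ * ∑ _i : Idx (F.P K),
        (9 * (F.L : ℝ) ^ 2 / 2 * ∑ b ∈ univ.filter (fun b : PBond (F.P K) l => blockOf b.src = y), ‖pertVar V₀ V b‖ ^ 2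
          + 3 * (F.L : ℝ) / 2 * ∑ b ∈ univ.filter (fun b : PBond (F.P K) l => blockOf b.src = y), D l b)
      = 9 * (F.L : ℝ) ^ 2 / 2 * ∑ b : PBond (F.P K) l, ‖pertVar V₀ V b‖ ^ 2 + 3 * (F.L : ℝ) / 2 * ∑ b : PBond (F.P K) l, D l b := by
    rw [Prop7StairRem2Row.sum_idxMean_const_stairMajorant, sum_sum_filter_blockOf_eq, sum_sum_filter_blockOf_eq]
  have hBsum : ∑ y : Site (F.P K) (l + 1), ∑ b ∈ univ.filter (fun b : PBond (F.P K) l => blockOf b.src = y), ‖pertVar V₀ V b‖ ^ 2 = ∑ b : PBond (F.P K) l, ‖pertVar V₀ V b‖ ^ 2 :=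
    sum_sum_filter_blockOf_eq _
  simp only [hLHS]
  have hLd : (((F.P K).L : ℝ) ^ (F.P K).d)⁻¹ = ((F.L : ℝ) ^ 3)⁻¹ := by rw [hd, hLL]
  rw [hSRsum, hBsum, hLd] at hstep
  have hM0 : 0 ≤ ∑ b : PBond (F.P K) l, ‖pertVar V₀ V b‖ ^ 2 := Finset.sum_nonneg fun _ _ => sq_nonneg _
  have e171 : 19 * (3 * (F.L : ℝ)) ^ 2 = 171 * (F.L : ℝ) ^ 2 := by ring
  rw [e171] at hstep
  linarith [hstep]

end T3

end Summit.QuantumFields.YangMills.Theorems.Prop7FrameRem2RecursionT3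

end
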